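import Mathlib
import Summits.ValiantsHypothesis.ValiantsHypothesis.Theorems.AlgebraicKWGamesOneAlternationLowerBoundRun

/-!
# One-alternation algebraic KW protocols: structure of the generic run and the Zariski step

Support lemmas for item `stmt-ValiantsHypothesis-10302` (`…Theses.AlgebraicKWGames.OneAlternationLowerBound`),
continuing `AlgebraicKWGamesOneAlternationLowerBoundRun`:

* `Protocol.gen_alice`: since Alice speaks first, her generic messages do not depend on the identified
  set `E` and lie in `ℂ[x]`;
* `Protocol.gen_mem_adjoin`: every generic message of a round `< T` on the subspace `E` lies in the
  subalgebra generated by Alice's messages, the `x_e (e ∈ E)` and the free `y_e (e ∉ E)`;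
* `subst_perX_sub_perY_ne_zero`: `per(x) - per(y)` survives every proper identification;
* the Zariski step (`Protocol.genOut_not_mem`, `Protocol.exists_gen_killed`): the generic output cell on
  `E` is not in `E`, and identifying it kills some nonzero generic message
  (by `MvPolynomial.funext` over the infinite field `ℂ`).

Honest framing: bookkeeping for a toy-model lower bound; nothing here bears on VP versus VNP.
-/

open MvPolynomial

-- the summit and the problem share the name `ValiantsHypothesis` (D-0017 single-conjunct layout)
set_option linter.dupNamespace false

namespace Summit.ValiantsHypothesis.ValiantsHypothesis.Theorems.AlgebraicKWGames.OneAlt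

open scoped Classical

noncomputable section

variable {n : ℕ}

/-! ## Alice's subring `ℂ[x]` -/

/-- Alice's polynomial subring `ℂ[x] ⊆ ℂ[x, y]`. -/
def xSub : Subalgebra ℂ (R n) := Algebra.adjoin ℂ (Set.range fun c : Cell n => (X (Sum.inl c) : R n))

/-- The `x`-variables lie in `ℂ[x]`. -/
theorem X_inl_mem_xSub (c : Cell n) : (X (Sum.inl c) : R n) ∈ xSub :=
  Algebra.subset_adjoin ⟨c, rfl⟩

/-- Two algebra maps that agree on a set agree on the subalgebra it generates (pointwise form). -/
theorem algHom_apply_eq_of_eqOn {S : Set (R n)} (φ ψ : R n →ₐ[ℂ] R n) (h : ∀ s ∈ S, φ s = ψ s)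
    {q : R n} (hq : q ∈ Algebra.adjoin ℂ S) : φ q = ψ q :=
  (AlgHom.eqOn_adjoin_iff.mpr (fun s hs => h s hs)) hq

/-- `subst E` is the identity on `ℂ[x]`. -/
theorem subst_eq_self_of_mem_xSub (E : Finset (Cell n)) {q : R n} (hq : q ∈ xSub) : subst E q = q := by
  have := algHom_apply_eq_of_eqOn (subst E) (AlgHom.id ℂ (R n)) (S := Set.range fun c : Cell n =>
    (X (Sum.inl c) : R n)) (by rintro _ ⟨c, rfl⟩; simp) hq
  simpa using this

/-- A substitution instance of a polynomial lies in the subalgebra generated by the substituted values. -/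
theorem aeval_mem_adjoin_range {ι : Type*} (f : ι → R n) (q : MvPolynomial ι ℂ) :
    aeval f q ∈ Algebra.adjoin ℂ (Set.range f) := by
  rw [Algebra.adjoin_range_eq_range_aeval]
  exact ⟨q, rfl⟩

/-! ## Alice speaks first -/

variable {T : ℕ} (P : Protocol n T)

namespace Protocol

/-- Alice's rounds form an initial segment. -/
theorem even_of_lt {j t : ℕ} (hjt : j < t) (ht : Even (P.blk t)) : Even (P.blk j) := by
  have hbt : P.blk t = 0 := by
    have := P.le_one t
    rcases Nat.even_iff.mp ht with h
    omega
  have : P.blk j ≤ P.blk t := P.mono hjt.le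
  have hbj : P.blk j = 0 := by omega
  simp [hbj]

/-- **Alice's generic messages.**  In an Alice round `t` the generic message does not depend on `E`
and lies in `ℂ[x]`. -/
theorem gen_alice (E : Finset (Cell n)) :
    ∀ t, Even (P.blk t) → P.gen E t = P.gen ∅ t ∧ P.gen ∅ t ∈ xSub := by
  intro t
  induction t using Nat.strong_induction_on with
  | _ t ih =>
    intro ht
    have hprev : ∀ j : Fin t, P.gen E j = P.gen ∅ j := fun j =>
      (ih j j.2 (P.even_of_lt j.2 ht)).1
    have hvars : P.vars t = fun c => (X (Sum.inl c) : R n) := by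
      funext c; simp [vars, ht]
    -- the inner polynomial lies in `ℂ[x]`
    set inner : R n := aeval (Sum.elim (P.vars t) (fun j : Fin t => P.gen ∅ j))
      (P.msg t (fun j : Fin t => decide (P.gen ∅ (j : ℕ) = 0))) with hinner
    have hmem : inner ∈ xSub := by
      have h := aeval_mem_adjoin_range (Sum.elim (P.vars t) (fun j : Fin t => P.gen ∅ j))
        (P.msg t (fun j : Fin t => decide (P.gen ∅ (j : ℕ) = 0)))
      refine (Algebra.adjoin_le ?_) h
      rintro _ ⟨i, rfl⟩
      rcases i with c | j
      · simp only [Sum.elim_inl, hvars]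
        exact X_inl_mem_xSub c
      · simp only [Sum.elim_inr]
        exact (ih j j.2 (P.even_of_lt j.2 ht)).2
    have hE : P.gen E t = inner := by
      rw [gen_eq, step]
      simp only [hprev]
      rw [hinner, subst_eq_self_of_mem_xSub E hmem]
    have h0 : P.gen ∅ t = inner := by
      rw [gen_eq, step, hinner, subst_eq_self_of_mem_xSub ∅ hmem]
    exact ⟨hE.trans h0.symm, h0 ▸ hmem⟩

/-! ## Where the generic messages live -/

/-- Alice's generic messages of the rounds `< T`. -/
def AM : Set (R n) := (fun t => P.gen ∅ t) '' {t | t < T ∧ Even (P.blk t)}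

end Protocol

/-- The variables `x_e`, `e ∈ E`. -/
def XE (E : Finset (Cell n)) : Set (R n) := (fun c => (X (Sum.inl c) : R n)) '' (E : Set (Cell n))

/-- The variables `y_e`, `e ∈ S`. -/
def YC (S : Set (Cell n)) : Set (R n) := (fun c => (X (Sum.inr c) : R n)) '' S

namespace Protocol

/-- Alice's generic messages lie in `ℂ[x]`. -/
theorem AM_subset_xSub : P.AM ⊆ (xSub : Subalgebra ℂ (R n)) := by
  rintro _ ⟨t, ⟨-, ht⟩, rfl⟩
  exact (P.gen_alice ∅ t ht).2

/-- **Structure lemma.**  Every generic message of a round `< T` on the subspace `E` lies in the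
subalgebra generated by Alice's generic messages, the `x_e (e ∈ E)` and the `y_e (e ∉ E)`. -/
theorem gen_mem_adjoin (E : Finset (Cell n)) :
    ∀ t < T, P.gen E t ∈ Algebra.adjoin ℂ (P.AM ∪ XE E ∪ YC (↑E)ᶜ) := by
  intro t
  induction t using Nat.strong_induction_on with
  | _ t ih =>
    intro htT
    by_cases ht : Even (P.blk t)
    · rw [(P.gen_alice E t ht).1]
      exact Algebra.subset_adjoin (Or.inl (Or.inl ⟨t, ⟨htT, ht⟩, rfl⟩))
    · have hvars : P.vars t = fun c => (X (Sum.inr c) : R n) := by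
        funext c; simp [vars, ht]
      rw [gen_eq, step]
      set f : Cell n ⊕ Fin t → R n := Sum.elim (P.vars t) (fun j : Fin t => P.gen E j) with hf
      have hin := aeval_mem_adjoin_range f (P.msg t (fun j : Fin t => decide (P.gen E (j : ℕ) = 0)))
      have hmap : subst E (aeval f (P.msg t (fun j : Fin t => decide (P.gen E (j : ℕ) = 0)))) ∈
          (Algebra.adjoin ℂ (Set.range f)).map (subst E) := Subalgebra.mem_map.mpr ⟨_, hin, rfl⟩
      rw [AlgHom.map_adjoin] at hmap
      refine (Algebra.adjoin_le ?_) hmap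
      rintro _ ⟨_, ⟨i, rfl⟩, rfl⟩
      rcases i with c | j
      · simp only [hf, Sum.elim_inl, hvars, subst_X_inr]
        by_cases hc : c ∈ E
        · rw [if_pos hc]
          exact Algebra.subset_adjoin (Or.inl (Or.inr ⟨c, hc, rfl⟩))
        · rw [if_neg hc]
          exact Algebra.subset_adjoin (Or.inr ⟨c, hc, rfl⟩)
      · simp only [hf, Sum.elim_inr, subst_gen]
        exact ih j j.2 (lt_trans j.2 htT)

end Protocol

/-! ## The permanent difference survives proper identifications -/

/-- `per(x)`. -/
def perX : R n := rename Sum.inl (Literature.Computability.AlgebraicComplexity.perPoly (Fin n) ℂ)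

/-- `per(y)`. -/
def perY : R n := rename Sum.inr (Literature.Computability.AlgebraicComplexity.perPoly (Fin n) ℂ)

/-- Evaluating `per(x)`. -/
theorem eval_perX (p : Var n → ℂ) : eval p (perX : R n) =
    eval (fun c => p (Sum.inl c)) (Literature.Computability.AlgebraicComplexity.perPoly (Fin n) ℂ) := by
  rw [perX, eval_rename]; rfl

/-- Evaluating `per(y)`. -/
theorem eval_perY (p : Var n → ℂ) : eval p (perY : R n) =
    eval (fun c => p (Sum.inr c)) (Literature.Computability.AlgebraicComplexity.perPoly (Fin n) ℂ) := by
  rw [perY, eval_rename]; rfl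

/-- The permanent of the all-ones matrix differs from the permanent of the all-ones matrix with one
entry replaced by `2`. -/
theorem perPoly_eval_one_ne (e₀ : Cell n) :
    eval (fun _ : Cell n => (1 : ℂ)) (Literature.Computability.AlgebraicComplexity.perPoly (Fin n) ℂ) ≠
      eval (fun c : Cell n => if c = e₀ then (2 : ℂ) else 1)
        (Literature.Computability.AlgebraicComplexity.perPoly (Fin n) ℂ) := by
  obtain ⟨i₀, j₀⟩ := e₀
  set f : Equiv.Perm (Fin n) → ℕ := fun σ => ∏ i, (if ((σ i, i) : Cell n) = (i₀, j₀) then 2 else 1)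
    with hf
  have h1 : eval (fun _ : Cell n => (1 : ℂ))
      (Literature.Computability.AlgebraicComplexity.perPoly (Fin n) ℂ) =
      ((∑ σ : Equiv.Perm (Fin n), (1 : ℕ) : ℕ) : ℂ) := by
    rw [Literature.Computability.AlgebraicComplexity.eval_perPoly]
    simp [Matrix.permanent]
  have h2 : eval (fun c : Cell n => if c = (i₀, j₀) then (2 : ℂ) else 1)
      (Literature.Computability.AlgebraicComplexity.perPoly (Fin n) ℂ) =
      ((∑ σ : Equiv.Perm (Fin n), f σ : ℕ) : ℂ) := by
    rw [Literature.Computability.AlgebraicComplexity.eval_perPoly]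
    simp only [Matrix.permanent, Matrix.of_apply, hf]
    push_cast
    rfl
  rw [h1, h2]
  have hlt : (∑ σ : Equiv.Perm (Fin n), (1 : ℕ)) < ∑ σ : Equiv.Perm (Fin n), f σ := by
    have hle : ∀ σ : Equiv.Perm (Fin n), ∀ i ∈ (Finset.univ : Finset (Fin n)),
        1 ≤ (if ((σ i, i) : Cell n) = (i₀, j₀) then 2 else 1 : ℕ) := by
      intro σ i _; split_ifs <;> omega
    apply Finset.sum_lt_sum
    · intro σ _
      exact Finset.one_le_prod' (hle σ)
    · refine ⟨Equiv.swap i₀ j₀, Finset.mem_univ _, ?_⟩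
      have h2le : (2 : ℕ) ≤ f (Equiv.swap i₀ j₀) := by
        have := Finset.single_le_prod' (hle (Equiv.swap i₀ j₀)) (Finset.mem_univ j₀)
        simp only [hf]
        simpa [Equiv.swap_apply_right] using this
      omega
  exact_mod_cast hlt.ne

/-- **`per(x) - per(y)` survives.**  If `E` misses a cell, then `subst E (perX - perY) ≠ 0`. -/
theorem subst_perX_sub_perY_ne_zero (E : Finset (Cell n)) {e₀ : Cell n} (he₀ : e₀ ∉ E) :
    subst E (perX - perY : R n) ≠ 0 := by
  intro h
  set p₀ : Var n → ℂ := Sum.elim (fun _ => (1 : ℂ)) (fun c => if c = e₀ then (2 : ℂ) else 1) with hp₀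
  have hagree : ∀ c ∈ E, p₀ (Sum.inr c) = p₀ (Sum.inl c) := by
    intro c hc
    have : c ≠ e₀ := fun h => he₀ (h ▸ hc)
    simp [hp₀, this]
  have := congrArg (eval p₀) h
  rw [eval_subst_of_agree E p₀ hagree, map_sub, map_zero, eval_perX, eval_perY, sub_eq_zero] at this
  exact perPoly_eval_one_ne e₀ (by simpa [hp₀] using this)

/-! ## The Zariski step -/

namespace Protocol

/-- The genericity polynomial of the subspace `E`: the product of the nonzero generic messages of the
rounds `< T` and of `per(x) - per(y)` (after identification). -/
def Phi (E : Finset (Cell n)) : R n :=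
  (∏ t ∈ (Finset.range T).filter (fun t => P.gen E t ≠ 0), P.gen E t) * subst E (perX - perY)

/-- If `F ⊇ E` contains the generic output cell of `E`, then `Phi E` vanishes on the subspace `F`
(pointwise form). -/
theorem eval_identify_Phi_eq_zero {E F : Finset (Cell n)} (hEF : E ⊆ F) (he : P.genOut E ∈ F)
    (p : Var n → ℂ) : eval (identify F p) (P.Phi E) = 0 := by
  by_contra hne
  set p' := identify F p with hp'
  rw [Phi, map_mul, map_prod] at hne
  have hgen := Finset.prod_ne_zero_iff.mp (mul_ne_zero_iff.mp hne).1
  have hper := (mul_ne_zero_iff.mp hne).2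
  have hpE : ∀ c ∈ E, p' (Sum.inr c) = p' (Sum.inl c) := fun c hc => identify_agree F p (hEF hc)
  have key := P.generic_output_ne E p' hpE
    (fun t ht h0 => hgen t (Finset.mem_filter.mpr ⟨Finset.mem_range.mpr ht, h0⟩)) ?_
  · exact key (identify_agree F p he).symm
  · rw [eval_subst_of_agree E p' hpE, map_sub, eval_perX, eval_perY, sub_ne_zero] at hper
    exact hper

/-- **Zariski step, terminal case.**  The generic output cell of a proper subspace `E` is not one of the
identified cells. -/
theorem genOut_not_mem (E : Finset (Cell n)) {e₀ : Cell n} (he₀ : e₀ ∉ E) : P.genOut E ∉ E := by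
  intro he
  have hzero : subst E (P.Phi E) = 0 := by
    apply MvPolynomial.funext
    intro p
    rw [map_zero, ← eval_identify]
    exact P.eval_identify_Phi_eq_zero le_rfl he p
  rw [Phi, map_mul, map_prod, subst_idem, mul_eq_zero, Finset.prod_eq_zero_iff] at hzero
  rcases hzero with ⟨t, ht, h0⟩ | h0
  · rw [subst_gen] at h0
    exact (Finset.mem_filter.mp ht).2 h0
  · exact subst_perX_sub_perY_ne_zero E he₀ h0

/-- **Zariski step, progress case.**  Identifying the generic output cell `e` of `E` (assumed to
leave some cell free) kills a nonzero generic message of a round `< T`. -/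
theorem exists_gen_killed (E : Finset (Cell n)) {e₀ : Cell n} (he₀ : e₀ ∉ insert (P.genOut E) E) :
    ∃ t < T, P.gen E t ≠ 0 ∧ subst (insert (P.genOut E) E) (P.gen E t) = 0 := by
  set F := insert (P.genOut E) E with hF
  have hzero : subst F (P.Phi E) = 0 := by
    apply MvPolynomial.funext
    intro p
    rw [map_zero, ← eval_identify]
    exact P.eval_identify_Phi_eq_zero (Finset.subset_insert _ E) (Finset.mem_insert_self _ E) p
  rw [Phi, map_mul, map_prod, subst_subst_of_subset (Finset.subset_insert _ E), mul_eq_zero,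
    Finset.prod_eq_zero_iff] at hzero
  rcases hzero with ⟨t, ht, h0⟩ | h0
  · obtain ⟨htT, hne⟩ := Finset.mem_filter.mp ht
    exact ⟨t, Finset.mem_range.mp htT, hne, h0⟩
  · exact (subst_perX_sub_perY_ne_zero F he₀ h0).elim

end Protocol

end

end Summit.ValiantsHypothesis.ValiantsHypothesis.Theorems.AlgebraicKWGames.OneAlt
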